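/-
Copyright (c) 2026 the pub-hodgecm-mathlib formalisation cell (harness21).  Prover seat hodgecm-mathlib-K2E4-p23 (g2), Track B ∕ K2-LIT, h413 =
`stmt-HodgeConjecture-24833`, ENGINE E1, 5Res campaign «ENDGAME BY FAMILIES», ROADCARD §3′ (M2 v2 «SPECTRAL-MEASURE EXHAUSTION», (181)) file D4′b, deal (185) of K2E1-plan (g7):
the arch-central symbol action THROUGH the Plancherel isometry (hmc currency), part 1 = the abstract transfer + the model∕residue editions, hypothesis-first on `U`.
-/
import Summits.HodgeConjecture.HodgeConjecture.Theorems.K2E1PlancherelIsometryOfForm   -- ★ p859954 (this seat) P3a: the Gram isometry, its range, density of finite combinations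
import HarnessLib

/-!
# K2·E1 — `K2E1ArchCentralSymbolActionU2`: AN OPERATOR IS CARRIED TO ITS MODEL THROUGH THE GRAM ISOMETRY — `U ∘ T = S ∘ U` FROM `⟪T xᵢ, xⱼ⟫ = ⟪S uᵢ, uⱼ⟫`
# (ROADCARD §3′ D4′b: `U_χ R(h) U_χ* = M_{σ_h}` for arch-central `h` — the transfer engine, the equivariant-family edition, the scalar (residue-block) edition)

Track B ∕ K2-LIT, crux h413 = `stmt-HodgeConjecture-24833`, route of record `HCCMUnconditional`; cell `hodgecm-mathlib`, squad K2, ENGINE E1 (5Res campaign, M2 v2).  Prover seat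
`hodgecm-mathlib-K2E4-p23` (g2); deal (185).  THEOREMS ONLY (no `def`, no `instance`, no notation, no named-fact hypothesis, no `sorry`); Mathlib + ★ P3a; lane
`--supports stmt-HodgeConjecture-24833 --as helper` (count-neutral).  CLOSES NO SOCKET.

SETTING (★ P3a `K2E1PlancherelIsometryOfForm`).  `x : ι → H` (E1: the pseudo-Eisenstein series `θ_Ψ` of the K-finite section fields `Ψ` of one family), `u : ι → M` (E1: the models
`Ψ̂ = (residues, Mellin transform)`), `U : Sc →ₗᵢ[ℂ] M` on `Sc = closure span {x i}` with `U (x i) = u i` (★ P3a, from the Gram identity), `H` complete.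
* §1 **THE TRANSFER** `apply_isometry_map_eq_of_gram`, **`isometry_map_eq_map_isometry`**: for bounded `T : H →L H` preserving `Sc` (E1: `Θ_χ` is `G(𝔸)`-stable, `T` = the circle∘torus
  average `A_{w,a,q}` or any `R(h)`) and bounded `S : M →L M` preserving `closure span {u i}` (E1: multiplication by the symbol) with THE GRAM LETTER `hTS : ⟪T xᵢ, xⱼ⟫ = ⟪S uᵢ, uⱼ⟫`
  (E1: «T5a with the arch symbol inserted»), `U (T v) = S (U v)` for every `v ∈ Sc` — i.e. `U T U* = S` on `range U`.
* §2 **THE EQUIVARIANT-FAMILY EDITION** `isometry_map_eq_map_isometry_of_equivariant`: if `T (x i) = x (τ i)` and `S (u i) = u (τ i)` for a reindexing `τ : ι → ι` (E1: `A θ_Ψ = θ_{AΨ}` by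
  ★ (113)(ii-b)∕(iii) at section level — `A_{w,a,q} φ_z = Φ_{z+it_w,m}(a)·φ_z` — and `(AΨ)^ = σ·Ψ̂`), the Gram letter is AUTOMATIC from `hG`, so `U T = S U` on `Sc`.
* §3 **THE SCALAR EDITION** `map_eq_smul_of_gram_smul`: `⟪T xᵢ, xⱼ⟫ = ⟪c • uᵢ, uⱼ⟫` ⇒ `T v = c • v` on `Sc` (E1: on a residue block at a real simple pole `z_j` the arch-central operator IS
  the scalar `Φ_{z_j,m_w}(a)` — ★ 2c `circleAverage_residue_eq` ∕ `inner_rightRegular_torusAt_residue` supply the Gram letter).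
Part 2 (the E1 instance «`U_χ A_{w,a,q} U_χ* = M_{Φ_{½+i(·+t_w),m_w}(a)}` on the `(K′,κ)`-block») waits for D4′c's `θ_Ψ ∕ U_χ` currency at general K-type; its only E1 input is the
Gram letter, whose arch factor is ★ (113).
HONEST LABEL: HC_CM is proved only modulo the 7 printed citations (2 remaining named inputs: hLiu418 = `stmt-HodgeConjecture-24832`, h413 = `stmt-HodgeConjecture-24833`) until rung 0
closes; this file asserts no named fact and closes no socket; count-neutral.

## References
* [MoeglinWaldspurger1995] C. Mœglin, J.-L. Waldspurger, *Spectral decomposition and Eisenstein series* (1995), II.2.4, VI.2 (the Plancherel isometry intertwines the `G`-action).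
* [ReedSimonI1980] M. Reed, B. Simon, *Methods of Modern Mathematical Physics I* (1980), Thm. I.7, §VII.1 (unitary equivalence with multiplication operators).
-/

set_option autoImplicit false
-- the mandated namespace repeats the single-problem summit's segment (`HodgeConjecture.HodgeConjecture`)
set_option linter.dupNamespace false

noncomputable section

open Set Submodule
open scoped InnerProductSpace ComplexConjugate
open Summit.HodgeConjecture.HodgeConjecture.Cruxes.H413.K2E1PlancherelIsometryOfForm

namespace Summit.HodgeConjecture.HodgeConjecture.Cruxes.H413.K2E1ArchCentralSymbolActionU2

variable {ι H M : Type*} [NormedAddCommGroup H] [InnerProductSpace ℂ H] [CompleteSpace H] [NormedAddCommGroup M] [InnerProductSpace ℂ M]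

/-! ## §1 The transfer `U T = S U` from the Gram letter -/

omit [CompleteSpace H] in
/-- A vector of `closure span {u i}` orthogonal to every `u j` is zero. [folklore] -/
theorem eq_zero_of_mem_topologicalClosure_of_inner_eq_zero {u : ι → M} {w : M} (hw : w ∈ (span ℂ (Set.range u)).topologicalClosure)
    (horth : ∀ j, ⟪u j, w⟫_ℂ = 0) : w = 0 := by
  have hK : ((span ℂ (Set.range u) : Submodule ℂ M) : Set M) ⊆ {v : M | ⟪v, w⟫_ℂ = 0} := by
    intro v (hv : v ∈ span ℂ (Set.range u))
    show ⟪v, w⟫_ℂ = 0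
    refine span_induction (p := fun v _ => ⟪v, w⟫_ℂ = 0) (fun v hv' => ?_) (inner_zero_left _) (fun a b _ _ ha hb => ?_)
      (fun c a _ ha => ?_) hv
    · obtain ⟨j, rfl⟩ := hv'
      exact horth j
    · rw [inner_add_left, ha, hb, add_zero]
    · rw [inner_smul_left, ha, mul_zero]
  have hcl : w ∈ {v : M | ⟪v, w⟫_ℂ = 0} := by
    refine closure_minimal hK (isClosed_eq (continuous_id.inner continuous_const) continuous_const) ?_
    rwa [← topologicalClosure_coe]
  exact inner_self_eq_zero.1 hcl

/-- **ON THE GENERATORS**: `U (T xᵢ) = S uᵢ` — the difference lies in `range U = closure span {u j}` (★ P3a) and is orthogonal to every `uⱼ = U xⱼ` by the Gram letter and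
`⟪U a, U b⟫ = ⟪a, b⟫`. [cite: MoeglinWaldspurger1995, II.2.4] [cite: ReedSimonI1980, §VII.1] -/
theorem apply_isometry_map_eq_of_gram {x : ι → H} {u : ι → M} (U : (span ℂ (Set.range x)).topologicalClosure →ₗᵢ[ℂ] M)
    (hU : ∀ i, U ⟨x i, mem_topologicalClosure_span x i⟩ = u i) (T : H →L[ℂ] H)
    (hT : ∀ v ∈ (span ℂ (Set.range x)).topologicalClosure, T v ∈ (span ℂ (Set.range x)).topologicalClosure)
    (S : M →L[ℂ] M) (hS : ∀ i, S (u i) ∈ (span ℂ (Set.range u)).topologicalClosure) (hTS : ∀ i j, ⟪T (x i), x j⟫_ℂ = ⟪S (u i), u j⟫_ℂ) (i : ι) :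
    U ⟨T (x i), hT _ (mem_topologicalClosure_span x i)⟩ = S (u i) := by
  rw [← sub_eq_zero]
  refine eq_zero_of_mem_topologicalClosure_of_inner_eq_zero (u := u) ?_ fun j => ?_
  · refine Submodule.sub_mem _ ?_ (hS i)
    rw [← SetLike.mem_coe, ← range_linearIsometry_eq_topologicalClosure_span U hU]
    exact Set.mem_range_self _
  · rw [inner_sub_right, ← hU j, LinearIsometry.inner_map_map, sub_eq_zero]
    change ⟪x j, T (x i)⟫_ℂ = ⟪U ⟨x j, mem_topologicalClosure_span x j⟩, S (u i)⟫_ℂ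
    rw [hU j, ← inner_conj_symm, hTS, inner_conj_symm]

/-- **THE TRANSFER `U ∘ T = S ∘ U` ON THE CLOSED SPAN** (density of finite combinations ★ P3a + continuity): `U (T v) = S (U v)` for every `v ∈ Sc`.  E1 reading: `U_χ R(h) U_χ* = M_{σ_h}`
on `range U_χ` for arch-central `h`. [cite: MoeglinWaldspurger1995, II.2.4, VI.2] [cite: ReedSimonI1980, §VII.1] -/
theorem isometry_map_eq_map_isometry {x : ι → H} {u : ι → M} (U : (span ℂ (Set.range x)).topologicalClosure →ₗᵢ[ℂ] M)
    (hU : ∀ i, U ⟨x i, mem_topologicalClosure_span x i⟩ = u i) (T : H →L[ℂ] H)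
    (hT : ∀ v ∈ (span ℂ (Set.range x)).topologicalClosure, T v ∈ (span ℂ (Set.range x)).topologicalClosure)
    (S : M →L[ℂ] M) (hS : ∀ i, S (u i) ∈ (span ℂ (Set.range u)).topologicalClosure) (hTS : ∀ i j, ⟪T (x i), x j⟫_ℂ = ⟪S (u i), u j⟫_ℂ)
    (v : (span ℂ (Set.range x)).topologicalClosure) :
    U ⟨T v, hT v v.2⟩ = S (U v) := by
  -- the two sides as continuous maps of `v`
  set TU : (span ℂ (Set.range x)).topologicalClosure → M := fun v => U ⟨T v, hT v v.2⟩ with hTU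
  have hTr : Continuous fun v : (span ℂ (Set.range x)).topologicalClosure => (⟨T v, hT v v.2⟩ : (span ℂ (Set.range x)).topologicalClosure) :=
    (T.continuous.comp continuous_subtype_val).subtype_mk _
  have hc1 : Continuous TU := U.continuous.comp hTr
  have hc2 : Continuous fun v : (span ℂ (Set.range x)).topologicalClosure => S (U v) := S.continuous.comp U.continuous
  -- they agree on finite combinations
  have hagree : ∀ l : ι →₀ ℂ, TU ⟨Finsupp.linearCombination ℂ x l, linearCombination_mem_topologicalClosure x l⟩ =
      S (U ⟨Finsupp.linearCombination ℂ x l, linearCombination_mem_topologicalClosure x l⟩) := fun l => by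
    rw [linearIsometry_apply_linearCombination U hU l, hTU]
    simp only
    -- linearity in `l`: both sides are `Σ lᵢ (…)`
    have hlin : ∀ l : ι →₀ ℂ, (⟨T (Finsupp.linearCombination ℂ x l), hT _ (linearCombination_mem_topologicalClosure x l)⟩ : (span ℂ (Set.range x)).topologicalClosure) =
        Finsupp.linearCombination ℂ (fun i => (⟨T (x i), hT _ (mem_topologicalClosure_span x i)⟩ : (span ℂ (Set.range x)).topologicalClosure)) l := fun l => by
      apply Subtype.ext
      simp only [Finsupp.linearCombination_apply, Finsupp.sum, map_sum, map_smul, AddSubmonoidClass.coe_finsetSum, Submodule.coe_smul]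
    rw [hlin, Finsupp.linearCombination_apply, Finsupp.linearCombination_apply, map_finsuppSum, map_finsuppSum]
    refine Finsupp.sum_congr fun i _ => ?_
    rw [map_smul, map_smul, apply_isometry_map_eq_of_gram U hU T hT S hS hTS i]
  -- density
  have heq : TU = fun v => S (U v) :=
    Continuous.ext_on (denseRange_codRestrict_linearCombination x) hc1 hc2 fun v hv => by
      obtain ⟨l, rfl⟩ := hv
      exact hagree l
  exact congrFun heq v

/-! ## §2 The equivariant-family edition: the Gram letter is automatic -/

/-- **EQUIVARIANT FAMILIES**: if `T xᵢ = x (τ i)` and `S uᵢ = u (τ i)` for a reindexing `τ` (E1: `A θ_Ψ = θ_{AΨ}` and `(AΨ)^ = σ·Ψ̂`, the family being stable under `A`), then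
`⟪T xᵢ, xⱼ⟫ = ⟪S uᵢ, uⱼ⟫` follows from the Gram identity and `U T = S U` on `Sc`. [cite: MoeglinWaldspurger1995, II.2.4, VI.2] -/
theorem isometry_map_eq_map_isometry_of_equivariant {x : ι → H} {u : ι → M} (hG : ∀ i j, ⟪x i, x j⟫_ℂ = ⟪u i, u j⟫_ℂ)
    (U : (span ℂ (Set.range x)).topologicalClosure →ₗᵢ[ℂ] M) (hU : ∀ i, U ⟨x i, mem_topologicalClosure_span x i⟩ = u i) (T : H →L[ℂ] H)
    (hT : ∀ v ∈ (span ℂ (Set.range x)).topologicalClosure, T v ∈ (span ℂ (Set.range x)).topologicalClosure)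
    (S : M →L[ℂ] M) (τ : ι → ι) (hTx : ∀ i, T (x i) = x (τ i)) (hSu : ∀ i, S (u i) = u (τ i))
    (v : (span ℂ (Set.range x)).topologicalClosure) :
    U ⟨T v, hT v v.2⟩ = S (U v) :=
  isometry_map_eq_map_isometry U hU T hT S (fun i => (hSu i).symm ▸ mem_topologicalClosure_span u (τ i))
    (fun i j => by rw [hTx, hSu, hG]) v

/-! ## §3 The scalar edition: residue blocks -/

/-- **SCALAR EDITION**: if `⟪T xᵢ, xⱼ⟫ = ⟪c • uᵢ, uⱼ⟫` for all `i, j` then `T v = c • v` on `Sc` (transfer with `S = c • id`, then `U` is injective).  E1: on a residue block the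
arch-central operator acts by the scalar `Φ_{z_j,m_w}(a)` (Gram letter from ★ 2c `circleAverage_residue_eq`). [cite: MoeglinWaldspurger1995, VI.2] -/
theorem map_eq_smul_of_gram_smul {x : ι → H} {u : ι → M} (U : (span ℂ (Set.range x)).topologicalClosure →ₗᵢ[ℂ] M)
    (hU : ∀ i, U ⟨x i, mem_topologicalClosure_span x i⟩ = u i) (T : H →L[ℂ] H)
    (hT : ∀ v ∈ (span ℂ (Set.range x)).topologicalClosure, T v ∈ (span ℂ (Set.range x)).topologicalClosure)
    (c : ℂ) (hTS : ∀ i j, ⟪T (x i), x j⟫_ℂ = ⟪c • u i, u j⟫_ℂ) (v : (span ℂ (Set.range x)).topologicalClosure) :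
    T v = c • (v : H) := by
  have h := isometry_map_eq_map_isometry U hU T hT (c • ContinuousLinearMap.id ℂ M)
    (fun i => Submodule.smul_mem _ c (mem_topologicalClosure_span u i)) (fun i j => by rw [hTS]; rfl) v
  have h' : U ⟨T v, hT v v.2⟩ = U (c • v) := by rw [h, map_smul]; rfl
  have h2 := U.injective h'
  rw [Subtype.ext_iff] at h2
  simpa using h2

end Summit.HodgeConjecture.HodgeConjecture.Cruxes.H413.K2E1ArchCentralSymbolActionU2

end
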